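import Literature.Analysis.SpecialFunctions.GegenbauerExplicitODE
import Literature.Analysis.SpecialFunctions.GegenbauerHeatPositivity
import Literature.Analysis.SpecialFunctions.GegenbauerBivariate
import Mathlib.MeasureTheory.Integral.IntervalIntegral.FundThmCalculus
import Mathlib.RingTheory.Polynomial.Pochhammer
import HarnessLib

/-!
# Orthogonality and squared norms of the Gegenbauer sums `C_n^{(k+1/2)}` on `[-1, 1]`

For `k ∈ ℕ` and `a = k + 1/2` the explicit Gegenbauer sums `C_n^{(a)}` of
`GegenbauerExplicitODE.lean` are orthogonal on `[-1, 1]` for the weight `ρ = (1-s²)^k`, and their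
squared norms `h_n = ∫_{-1}^{1} ρ C_n²` satisfy `(n + a) h_n = a h_0 C_n(1)` — the form of the
classical `h_n = π 2^{1-2a} Γ(n+2a) / (n! (n+a) Γ(a)²)`, `C_n(1) = (2a)_n/n!` (AAR (6.4.11'),
p. 302) that the zonal heat-kernel expansion of `S^{2k+2}` uses (`(n+a)/a = C_n(1) h_0 / h_n` is
the multiplicity of the degree-`n` spherical harmonics divided by `C_n(1)`).  Contents:

* `gegenbauerSum_eq_gegenbauerHom` — the explicit sum is the bivariate homogeneous form
  `gegenbauerHom a n (2s) 1` of `GegenbauerBivariate.lean`; hence `gegenbauerSum_rec`, the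
  three-term recurrence `(n+2) C_{n+2} = 2(n+1+a) s C_{n+1} - (n+2a) C_n` (AAR (6.4.16));
* `gegenbauerSum_at_one_rec` — `(n+1) C_{n+1}(1) = (n+2a) C_n(1)`;
* `integral_weight_mul_gegenbauerSum_mul_eq_zero` — **orthogonality** (from the self-adjoint form
  `(P C_n')' = -n(n+2a) ρ C_n`, `P = (1-s²)^{k+1}`, of `gegenbauerSum_ode`, and the fundamental
  theorem of calculus for `P (C_i' C_j - C_i C_j')`, which vanishes at `±1`);
* `gegenbauerNormSq_rec` — `(n+1+a)(n+1) h_{n+1} = (n+a)(n+2a) h_n` (recurrence × orthogonality);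
* `gegenbauerNormSq_eq` — **`(n + a) h_n = a h_0 C_n(1)`**.

Everything is proved; no named facts.

## References
* G. E. Andrews, R. Askey, R. Roy, *Special Functions*, CUP 1999, §6.4 ((6.4.11'), (6.4.16)) and
  the table p. 302.
-/

noncomputable section

open Set MeasureTheory intervalIntegral Finset
open scoped BigOperators Nat

namespace Literature.Analysis.SpecialFunctions

/-! ### The explicit sum is the bivariate homogeneous form; the three-term recurrence -/

/-- `(a)_m = ∏_{i<m} (a + i)` (Mathlib's `ascPochhammer` evaluated at `a`). [folklore] -/
theorem ascPochhammer_eval_eq_prod_range (a : ℝ) (m : ℕ) :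
    (ascPochhammer ℝ m).eval a = ∏ i ∈ Finset.range m, (a + (i : ℝ)) := by
  induction m with
  | zero => simp
  | succ m ih => rw [ascPochhammer_succ_eval, Finset.prod_range_succ, ih]

/-- **`C_n^{(a)}(s) = P^a_n(2s, 1)`**: the explicit sum is the bivariate homogeneous Gegenbauer
polynomial of `GegenbauerBivariate.lean` at `σ = 2s`, `π = 1`. [cite: AndrewsAskeyRoy1999, (6.4.11)] -/
theorem gegenbauerSum_eq_gegenbauerHom (a : ℝ) (n : ℕ) (s : ℝ) :
    gegenbauerSum a n s = gegenbauerHom a n (2 * s) (1 : ℝ) := by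
  unfold gegenbauerSum gegenbauerHom
  rw [Finset.Nat.sum_antidiagonal_eq_sum_range_succ_mk]
  symm
  rw [← Finset.sum_subset (Finset.range_subset_range.2 (by omega : n / 2 + 1 ≤ n.succ))]
  · refine Finset.sum_congr rfl fun l hl => ?_
    have hl2 : 2 * l ≤ n := by have := Finset.mem_range.1 hl; omega
    rw [smul_eq_mul, gegenbauerA, gegenbauerCoeff, ascPochhammer_eval_eq_prod_range,
      Nat.cast_choose ℝ (by omega : l ≤ n - l), show n - l - l = n - 2 * l by omega]
    have h1 : ((n - l).factorial : ℝ) ≠ 0 := by positivity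
    have h2 : ((l.factorial : ℕ) : ℝ) ≠ 0 := by positivity
    have h3 : (((n - 2 * l).factorial : ℕ) : ℝ) ≠ 0 := by positivity
    field_simp
  · intro l hl hl'
    have h1 := Finset.mem_range.1 hl
    have h2 : ¬ l < n / 2 + 1 := fun h => hl' (Finset.mem_range.2 h)
    rw [Nat.choose_eq_zero_of_lt (by omega : n - l < l)]
    simp

/-- **Three-term recurrence** `(n+2) C_{n+2}(s) = 2(n+1+a) s C_{n+1}(s) - (n+2a) C_n(s)`
(AAR (6.4.16)), transported from `gegenbauerHom_rec`. [cite: AndrewsAskeyRoy1999, (6.4.16)] -/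
theorem gegenbauerSum_rec (a : ℝ) (n : ℕ) (s : ℝ) :
    ((n : ℝ) + 2) * gegenbauerSum a (n + 2) s =
      ((n : ℝ) + 1 + a) * (2 * s * gegenbauerSum a (n + 1) s) -
        ((n : ℝ) + 2 * a) * gegenbauerSum a n s := by
  have h := gegenbauerHom_rec a (2 * s) (1 : ℝ) n
  simp only [smul_eq_mul, one_mul] at h
  rw [gegenbauerSum_eq_gegenbauerHom, gegenbauerSum_eq_gegenbauerHom,
    gegenbauerSum_eq_gegenbauerHom]
  exact h

/-- `(n+1) C_{n+1}(1) = (n+2a) C_n(1)` (so `C_n(1) = (2a)_n/n!`). [folklore] -/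
theorem gegenbauerSum_at_one_rec (a : ℝ) (n : ℕ) :
    ((n : ℝ) + 1) * gegenbauerSum a (n + 1) 1 = ((n : ℝ) + 2 * a) * gegenbauerSum a n 1 := by
  induction n with
  | zero => simp [gegenbauerSum_one]
  | succ n ih =>
    have h := gegenbauerSum_rec a n 1
    push_cast at h ih ⊢
    linear_combination h + ih

/-! ### Orthogonality for the weight `(1-s²)^k`, `a = k + 1/2` -/

section Orthogonality

variable (k : ℕ)

/-- The self-adjoint form of the ultraspherical equation:
`(P C_n')' = -n(n+2k+1) ρ C_n` with `P = (1-s²)^{k+1}`, `ρ = (1-s²)^k`. [folklore] -/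
theorem hasDerivAt_flux_mul_gegenbauerSumD (n : ℕ) (s : ℝ) :
    HasDerivAt (fun x => (1 - x ^ 2) ^ (k + 1) * gegenbauerSumD ((k : ℝ) + 1 / 2) n x)
      (-((n : ℝ) * ((n : ℝ) + 2 * k + 1)) * ((1 - s ^ 2) ^ k * gegenbauerSum ((k : ℝ) + 1 / 2) n s))
      s := by
  have h := (hasDerivAt_ultrasphericalFlux k s).mul (hasDerivAt_gegenbauerSumD ((k : ℝ) + 1 / 2) n s)
  refine h.congr_deriv ?_
  have hode := gegenbauerSum_ode ((k : ℝ) + 1 / 2) n s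
  rw [pow_succ]
  linear_combination (1 - s ^ 2) ^ k * hode

/-- **Orthogonality**: `∫_{-1}^{1} (1-s²)^k C_i(s) C_j(s) ds = 0` for `i ≠ j` (`a = k + 1/2`).
[cite: AndrewsAskeyRoy1999, §6.4 (orthogonality of ultraspherical polynomials)] -/
theorem integral_weight_mul_gegenbauerSum_mul_eq_zero {i j : ℕ} (hij : i ≠ j) :
    ∫ s in (-1 : ℝ)..1, (1 - s ^ 2) ^ k *
      (gegenbauerSum ((k : ℝ) + 1 / 2) i s * gegenbauerSum ((k : ℝ) + 1 / 2) j s) = 0 := by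
  set a : ℝ := (k : ℝ) + 1 / 2 with ha
  set H : ℝ → ℝ := fun s => (1 - s ^ 2) ^ (k + 1) * gegenbauerSumD a i s * gegenbauerSum a j s -
    gegenbauerSum a i s * ((1 - s ^ 2) ^ (k + 1) * gegenbauerSumD a j s) with hH
  set li : ℝ := (i : ℝ) * ((i : ℝ) + 2 * k + 1) with hli
  set lj : ℝ := (j : ℝ) * ((j : ℝ) + 2 * k + 1) with hlj
  have hderiv : ∀ s : ℝ, HasDerivAt H ((lj - li) * ((1 - s ^ 2) ^ k *
      (gegenbauerSum a i s * gegenbauerSum a j s))) s := by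
    intro s
    have h1 := ((hasDerivAt_flux_mul_gegenbauerSumD k i s).mul (hasDerivAt_gegenbauerSum a j s))
    have h2 := ((hasDerivAt_gegenbauerSum a i s).mul (hasDerivAt_flux_mul_gegenbauerSumD k j s))
    refine (h1.sub h2).congr_deriv ?_
    simp only [hli, hlj]
    ring
  have hint : IntervalIntegrable (fun s => (lj - li) * ((1 - s ^ 2) ^ k *
      (gegenbauerSum a i s * gegenbauerSum a j s))) volume (-1) 1 :=
    (continuous_const.mul ((by fun_prop : Continuous fun s : ℝ => (1 - s ^ 2) ^ k).mul
      ((continuous_gegenbauerSum a i).mul (continuous_gegenbauerSum a j)))).intervalIntegrable _ _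
  have hftc := intervalIntegral.integral_eq_sub_of_hasDerivAt (fun s _ => hderiv s) hint
  have hH1 : H 1 = 0 := by simp [hH]
  have hH2 : H (-1) = 0 := by simp [hH]
  rw [hH1, hH2, sub_self, intervalIntegral.integral_const_mul] at hftc
  have hne : lj - li ≠ 0 := by
    rw [hli, hlj]
    intro h
    have hij' : (i : ℝ) ≠ j := by exact_mod_cast hij
    have : ((j : ℝ) - i) * ((j : ℝ) + i + 2 * k + 1) = 0 := by linear_combination h
    rcases mul_eq_zero.1 this with h0 | h0
    · exact hij' (by linarith)
    · have : (0 : ℝ) ≤ i := Nat.cast_nonneg i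
      have : (0 : ℝ) ≤ j := Nat.cast_nonneg j
      linarith
  exact (mul_eq_zero.1 hftc).resolve_left hne

/-! ### The squared norms -/

/-- `(n+1) h_{n+1} = (n+a) ∫ ρ (2s) C_n C_{n+1}` (the recurrence for `C_{n+1}` integrated against
`ρ C_{n+1}`, the `C_{n-1}` term dropping out by orthogonality). [folklore] -/
theorem gegenbauerNormSq_succ_eq (n : ℕ) :
    ((n : ℝ) + 1) * ∫ s in (-1 : ℝ)..1, (1 - s ^ 2) ^ k *
        (gegenbauerSum ((k : ℝ) + 1 / 2) (n + 1) s * gegenbauerSum ((k : ℝ) + 1 / 2) (n + 1) s) =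
      ((n : ℝ) + ((k : ℝ) + 1 / 2)) * ∫ s in (-1 : ℝ)..1, (1 - s ^ 2) ^ k *
        (2 * s * gegenbauerSum ((k : ℝ) + 1 / 2) n s * gegenbauerSum ((k : ℝ) + 1 / 2) (n + 1) s) := by
  set a : ℝ := (k : ℝ) + 1 / 2 with ha
  have hc : ∀ m : ℕ, Continuous (gegenbauerSum a m) := continuous_gegenbauerSum a
  have hρ : Continuous fun s : ℝ => (1 - s ^ 2) ^ k := by fun_prop
  rcases n with _ | n
  · -- `h_1 = a ∫ ρ (2s) C_0 C_1` directly (`C_0 = 1`, `C_1 = 2as`)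
    rw [← intervalIntegral.integral_const_mul, ← intervalIntegral.integral_const_mul]
    refine intervalIntegral.integral_congr fun s _ => ?_
    simp only [zero_add, Nat.cast_zero, gegenbauerSum_zero, gegenbauerSum_one]
    ring
  · -- from the recurrence for `C_{n+2}`
    have horth := integral_weight_mul_gegenbauerSum_mul_eq_zero k (i := n) (j := n + 2) (by omega)
    have hrec : ∀ s : ℝ, ((n : ℝ) + 2) * gegenbauerSum a (n + 2) s =
        ((n : ℝ) + 1 + a) * (2 * s * gegenbauerSum a (n + 1) s) -
          ((n : ℝ) + 2 * a) * gegenbauerSum a n s := gegenbauerSum_rec a n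
    have hI1 : IntervalIntegrable (fun s => (1 - s ^ 2) ^ k *
        (2 * s * gegenbauerSum a (n + 1) s * gegenbauerSum a (n + 1 + 1) s)) volume (-1) 1 :=
      (hρ.mul (((continuous_const.mul continuous_id).mul (hc _)).mul (hc _))).intervalIntegrable _ _
    have hI2 : IntervalIntegrable (fun s => (1 - s ^ 2) ^ k *
        (gegenbauerSum a n s * gegenbauerSum a (n + 2) s)) volume (-1) 1 :=
      (hρ.mul ((hc _).mul (hc _))).intervalIntegrable _ _
    have key : ∫ s in (-1 : ℝ)..1, ((n : ℝ) + 1 + 1) * ((1 - s ^ 2) ^ k *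
        (gegenbauerSum a (n + 1 + 1) s * gegenbauerSum a (n + 1 + 1) s)) =
        ∫ s in (-1 : ℝ)..1, (((n : ℝ) + 1 + a) * ((1 - s ^ 2) ^ k *
          (2 * s * gegenbauerSum a (n + 1) s * gegenbauerSum a (n + 1 + 1) s)) -
          ((n : ℝ) + 2 * a) * ((1 - s ^ 2) ^ k * (gegenbauerSum a n s * gegenbauerSum a (n + 2) s))) := by
      refine intervalIntegral.integral_congr fun s _ => ?_
      have h := hrec s
      simp only [show n + 1 + 1 = n + 2 by ring] at h ⊢
      linear_combination (1 - s ^ 2) ^ k * gegenbauerSum a (n + 2) s * h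
    rw [intervalIntegral.integral_sub (hI1.const_mul _) (hI2.const_mul _),
      intervalIntegral.integral_const_mul, intervalIntegral.integral_const_mul,
      intervalIntegral.integral_const_mul, horth, mul_zero, sub_zero] at key
    push_cast
    exact key

/-- `(n+1+a) ∫ ρ (2s) C_n C_{n+1} = (n+2a) h_n` (the recurrence for `C_{n+2}`... no: for `C_{n+1}`,
integrated against `ρ C_n`, the `C_{n+2}`-free form: `0 = (n+2)∫ρ C_{n+2} C_n
= (n+1+a)∫ρ 2s C_{n+1} C_n - (n+2a) h_n`). [folklore] -/
theorem gegenbauerCross_eq_normSq (n : ℕ) :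
    ((n : ℝ) + 1 + ((k : ℝ) + 1 / 2)) * ∫ s in (-1 : ℝ)..1, (1 - s ^ 2) ^ k *
        (2 * s * gegenbauerSum ((k : ℝ) + 1 / 2) n s * gegenbauerSum ((k : ℝ) + 1 / 2) (n + 1) s) =
      ((n : ℝ) + 2 * ((k : ℝ) + 1 / 2)) * ∫ s in (-1 : ℝ)..1, (1 - s ^ 2) ^ k *
        (gegenbauerSum ((k : ℝ) + 1 / 2) n s * gegenbauerSum ((k : ℝ) + 1 / 2) n s) := by
  set a : ℝ := (k : ℝ) + 1 / 2 with ha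
  have hc : ∀ m : ℕ, Continuous (gegenbauerSum a m) := continuous_gegenbauerSum a
  have hρ : Continuous fun s : ℝ => (1 - s ^ 2) ^ k := by fun_prop
  have horth := integral_weight_mul_gegenbauerSum_mul_eq_zero k (i := n + 2) (j := n) (by omega)
  have hrec : ∀ s : ℝ, ((n : ℝ) + 2) * gegenbauerSum a (n + 2) s =
      ((n : ℝ) + 1 + a) * (2 * s * gegenbauerSum a (n + 1) s) -
        ((n : ℝ) + 2 * a) * gegenbauerSum a n s := gegenbauerSum_rec a n
  have hI1 : IntervalIntegrable (fun s => (1 - s ^ 2) ^ k *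
      (2 * s * gegenbauerSum a n s * gegenbauerSum a (n + 1) s)) volume (-1) 1 :=
    (hρ.mul (((continuous_const.mul continuous_id).mul (hc _)).mul (hc _))).intervalIntegrable _ _
  have hI2 : IntervalIntegrable (fun s => (1 - s ^ 2) ^ k *
      (gegenbauerSum a n s * gegenbauerSum a n s)) volume (-1) 1 :=
    (hρ.mul ((hc _).mul (hc _))).intervalIntegrable _ _
  have key : ∫ s in (-1 : ℝ)..1, ((n : ℝ) + 2) * ((1 - s ^ 2) ^ k *
      (gegenbauerSum a (n + 2) s * gegenbauerSum a n s)) =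
      ∫ s in (-1 : ℝ)..1, (((n : ℝ) + 1 + a) * ((1 - s ^ 2) ^ k *
        (2 * s * gegenbauerSum a n s * gegenbauerSum a (n + 1) s)) -
        ((n : ℝ) + 2 * a) * ((1 - s ^ 2) ^ k * (gegenbauerSum a n s * gegenbauerSum a n s))) := by
    refine intervalIntegral.integral_congr fun s _ => ?_
    linear_combination (1 - s ^ 2) ^ k * gegenbauerSum a n s * hrec s
  rw [intervalIntegral.integral_sub (hI1.const_mul _) (hI2.const_mul _),
    intervalIntegral.integral_const_mul, intervalIntegral.integral_const_mul,
    intervalIntegral.integral_const_mul, horth, mul_zero] at key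
  linarith

/-- **The norm recurrence** `(n+1+a)(n+1) h_{n+1} = (n+a)(n+2a) h_n`, i.e.
`h_{n+1}/h_n = (n+a)(n+2a)/((n+1)(n+1+a))`. [cite: AndrewsAskeyRoy1999, §6.4 (norms of C_n^λ)] -/
theorem gegenbauerNormSq_rec (n : ℕ) :
    ((n : ℝ) + 1 + ((k : ℝ) + 1 / 2)) * ((n : ℝ) + 1) * ∫ s in (-1 : ℝ)..1, (1 - s ^ 2) ^ k *
        (gegenbauerSum ((k : ℝ) + 1 / 2) (n + 1) s * gegenbauerSum ((k : ℝ) + 1 / 2) (n + 1) s) =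
      ((n : ℝ) + ((k : ℝ) + 1 / 2)) * ((n : ℝ) + 2 * ((k : ℝ) + 1 / 2)) *
        ∫ s in (-1 : ℝ)..1, (1 - s ^ 2) ^ k *
          (gegenbauerSum ((k : ℝ) + 1 / 2) n s * gegenbauerSum ((k : ℝ) + 1 / 2) n s) := by
  have h1 := gegenbauerNormSq_succ_eq k n
  have h2 := gegenbauerCross_eq_normSq k n
  set A := ∫ s in (-1 : ℝ)..1, (1 - s ^ 2) ^ k *
    (gegenbauerSum ((k : ℝ) + 1 / 2) (n + 1) s * gegenbauerSum ((k : ℝ) + 1 / 2) (n + 1) s)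
  set B := ∫ s in (-1 : ℝ)..1, (1 - s ^ 2) ^ k *
    (2 * s * gegenbauerSum ((k : ℝ) + 1 / 2) n s * gegenbauerSum ((k : ℝ) + 1 / 2) (n + 1) s)
  set C := ∫ s in (-1 : ℝ)..1, (1 - s ^ 2) ^ k *
    (gegenbauerSum ((k : ℝ) + 1 / 2) n s * gegenbauerSum ((k : ℝ) + 1 / 2) n s)
  linear_combination ((n : ℝ) + 1 + ((k : ℝ) + 1 / 2)) * h1 + ((n : ℝ) + ((k : ℝ) + 1 / 2)) * h2

/-- **`(n + a) h_n = a h_0 C_n(1)`** (`a = k + 1/2`, `h_n = ∫_{-1}^{1} (1-s²)^k C_n²`,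
`h_0 = ∫_{-1}^{1} (1-s²)^k`): the squared norms in the form used by the zonal heat-kernel expansion.
[cite: AndrewsAskeyRoy1999, §6.4 (norms of C_n^λ)] -/
theorem gegenbauerNormSq_eq (n : ℕ) :
    ((n : ℝ) + ((k : ℝ) + 1 / 2)) * ∫ s in (-1 : ℝ)..1, (1 - s ^ 2) ^ k *
        (gegenbauerSum ((k : ℝ) + 1 / 2) n s * gegenbauerSum ((k : ℝ) + 1 / 2) n s) =
      ((k : ℝ) + 1 / 2) * (∫ s in (-1 : ℝ)..1, (1 - s ^ 2) ^ k) *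
        gegenbauerSum ((k : ℝ) + 1 / 2) n 1 := by
  induction n with
  | zero =>
    simp only [Nat.cast_zero, zero_add, gegenbauerSum_zero, mul_one]
  | succ n ih =>
    have h1 := gegenbauerNormSq_rec k n
    have h2 := gegenbauerSum_at_one_rec ((k : ℝ) + 1 / 2) n
    set A := ∫ s in (-1 : ℝ)..1, (1 - s ^ 2) ^ k *
      (gegenbauerSum ((k : ℝ) + 1 / 2) (n + 1) s * gegenbauerSum ((k : ℝ) + 1 / 2) (n + 1) s)
    set C := ∫ s in (-1 : ℝ)..1, (1 - s ^ 2) ^ k *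
      (gegenbauerSum ((k : ℝ) + 1 / 2) n s * gegenbauerSum ((k : ℝ) + 1 / 2) n s)
    set h0 := ∫ s in (-1 : ℝ)..1, (1 - s ^ 2) ^ k
    have hn : (n : ℝ) + 1 ≠ 0 := by positivity
    -- `(n+1+a)(n+1) A = (n+a)(n+2a) C`, `(n+a) C = a h0 g_n`, `(n+1) g_{n+1} = (n+2a) g_n`
    have key : ((n : ℝ) + 1) * (((n : ℝ) + 1 + ((k : ℝ) + 1 / 2)) * A) =
        ((n : ℝ) + 1) * (((k : ℝ) + 1 / 2) * h0 * gegenbauerSum ((k : ℝ) + 1 / 2) (n + 1) 1) := by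
      linear_combination h1 + ((n : ℝ) + 2 * ((k : ℝ) + 1 / 2)) * ih -
        ((k : ℝ) + 1 / 2) * h0 * h2
    push_cast
    exact mul_left_cancel₀ hn key

end Orthogonality

end Literature.Analysis.SpecialFunctions
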